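import Summits.ResolutionOfSingularities.ResolutionOfSingularities.Theorems.LossExitCone5
import HarnessLib

/-!
# LossPolygon — (P1)/(P2) of the g28 window (W2″): the RESIDUAL POLYGON of a walk state as FUNCTION-valued data,
and the EXACT transport law of its point set under an UNTRANSLATED plateau move (CJS's `(0:1)` / `(1:0)` moves)

decomp-res-lens-3, gen 27, rev 4b (row 220e window (W2″): «(P1) numeric invariants + Finset point set as FUNCTION-valued
defs of the run state = admissible tools at 0; (P2) untranslated Ψ-laws = tools 0 banked by name»).  TOOLS, score 0.

Dictionary (SEED-g28 §1 (B′)/(B″); [CJS2020] = Cossart–Jannsen–Saito(–Schober), LNM 2270, Def. 11.1 p.145, Lemmas 12.1/12.2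
pp.150–151): at a state with walls `r` and shade `s`, frame `(a, b ; c)` = (`u₁ = u_a`, `u₂ = u_b`, `y = u_c`), a monomial
`u^D` of `F` with `D c < s + r c` gives the point `((D a − r a)/(s + r c − D c), (D b − r b)/(s + r c − D c)) ∈ ℚ²`
(`resPoint`); the point set `polyPts` generates Hironaka's polyhedron `Δ(F/u^r ; u_a, u_b ; u_c)`.

* §1 `support_succ_untranslated` — at a move with `W.b t = 0` the support of `F_{t+1}` is EXACTLY the image of the support
  of `F_t` under `chartExponent q (W.j t)` (no cleaning happens: a `q`-th power image exponent has a `q`-th power preimage,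
  `isPthPowerExponent_of_chartExponent`).
* §2 `resPoint`, `polyPts`, `psi01`, `psi10` and the pointwise laws `resPoint_chartExponent_snd/fst`:
  chart `b` (= `u₂`) acts by `Ψ₍₀:₁₎(x₁,x₂) = (x₁, x₁ + x₂ − 1)`, chart `a` (= `u₁`) by `Ψ₍₁:₀₎(x₁,x₂) = (x₁ + x₂ − 1, x₂)`
  [CJS2020 Lemma 12.2 / 12.1].
* §3 `polyPts_succ_chart_snd/fst` — the walk-level law: `polyPts` after an untranslated move in chart `b` (resp. `a`) on a
  plateau of shade `s` is the `Ψ`-image of `polyPts` before (hypotheses: the wall bookkeeping `r'_a = r_a`, `r'_b + q = s + r_a + r_b`,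
  `r_c = r'_c = 0`, which `LossIsFatalLayer.run_invariant` / `BoundaryLedger.r_succ_eq` supply at a run state); §5 the walk-level
  VERTEX LAWS `alphaOf/betaOf/zetaOf_polyPts_succ_chart_snd/fst` (composition of §3 and §4).

* §4 `vertexOf`/`alphaOf`/`betaOf`, `dVertexOf`/`deltaOf`/`gammaMinusOf`, `epsOf`/`zetaOf` (function-valued, junk `0` on `∅`)
  and the VERTEX LAWS for finite point sets: `vertexOf_image_psi01` (`α' = α`, `β' = α + β − 1`), `vertexOf_image_psi10`
  (`α' = δ − 1`, `β' = γ⁻`), `gammaMinusOf_le_betaOf` (`γ⁻ ≤ β`), the mirror laws for `(ε, ζ)`, and the clock inequalities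
  `betaOf_add_zetaOf_image_psi01/psi10` (`β + ζ` drops by `≥ 1 − α` resp. `≥ 1 − ε`).

Imports only the landed tree (`Theorems.LossExitCone5`).  No `sorry`, standard axioms.
-/

open MvPolynomial Finset
open Literature.AlgebraicGeometry.Resolution
open Literature.AlgebraicGeometry.Resolution.Hauser2010
open Literature.AlgebraicGeometry.Resolution.PointBlowup
open Summit.ResolutionOfSingularities.ResolutionOfSingularities.Theorems.TightDefectClasses
open Summit.ResolutionOfSingularities.ResolutionOfSingularities.Theorems.TightDefectStrongWalks
open Summit.ResolutionOfSingularities.ResolutionOfSingularities.Theorems.ItineraryCutClasses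
open Summit.ResolutionOfSingularities.ResolutionOfSingularities.Theorems.BoundaryLedger
open Summit.ResolutionOfSingularities.ResolutionOfSingularities.Theorems.ProximityCut
open Summit.ResolutionOfSingularities.ResolutionOfSingularities.Theorems.LossExitCone

namespace Summit.ResolutionOfSingularities.ResolutionOfSingularities.Theorems.LossPolygon

variable {K : Type} [Field K] [DecidableEq K]
variable {q : ℕ} {s₀ : State (Fin 3) K}

/-! ## §1 Support transport at an untranslated move -/

/-- If the chart image `chartExponent q j d` of an exponent of degree `≥ q` is a `q`-th power exponent, so is `d`.
[folklore] -/
theorem isPthPowerExponent_of_chartExponent {j : Fin 3} {d : Fin 3 →₀ ℕ} (hq : q ≤ d.degree)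
    (h : IsPthPowerExponent q (chartExponent q j d)) : IsPthPowerExponent q d := by
  classical
  rw [isPthPowerExponent_iff] at h ⊢
  -- the two letters other than `j`
  obtain ⟨a, b, hab, haj, hbj⟩ : ∃ a b : Fin 3, a ≠ b ∧ a ≠ j ∧ b ≠ j := by
    fin_cases j
    · exact ⟨1, 2, by decide, by decide, by decide⟩
    · exact ⟨0, 2, by decide, by decide, by decide⟩
    · exact ⟨0, 1, by decide, by decide, by decide⟩
  have ha : q ∣ d a := by have := h a; rwa [chartExponent_apply, if_neg haj] at this
  have hb : q ∣ d b := by have := h b; rwa [chartExponent_apply, if_neg hbj] at this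
  have hj : q ∣ d.degree - q := by have := h j; rwa [chartExponent_apply, if_pos rfl] at this
  have hdeg : q ∣ d.degree := by
    have := Nat.dvd_add hj (dvd_refl q)
    rwa [Nat.sub_add_cancel hq] at this
  have hsum : d.degree = d a + d b + d j := degree_fin3 hab haj hbj d
  have hdj : d j = d.degree - d a - d b := by omega
  intro i
  by_cases hia : i = a
  · rw [hia]; exact ha
  by_cases hib : i = b
  · rw [hib]; exact hb
  have hij : i = j := by
    have hi := i.isLt; have ha' := a.isLt; have hb' := b.isLt; have hj' := j.isLt
    rw [Fin.ext_iff]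
    simp only [ne_eq, Fin.ext_iff] at hab haj hbj hia hib
    omega
  rw [hij, hdj]
  exact Nat.dvd_sub (Nat.dvd_sub hdeg ha) hb

/-- **Support transport (PROVED).**  At an untranslated move (`W.b t = 0`) the support of the next residual polynomial is
EXACTLY the chart image of the support: nothing is cleaned. [new] [folklore] -/
theorem support_succ_untranslated (hs : IsRoot q s₀) (W : ForcedWalk q s₀) (t : ℕ) (hb : W.b t = 0) :
    (W.st (t + 1)).F.support = (W.st t).F.support.image (chartExponent q (W.j t)) := by
  classical
  ext D
  rw [Finset.mem_image, mem_support_iff, st_succ_F_axis W t rfl hb, coeff_deletePthPowers]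
  constructor
  · intro h
    have hP : ¬ IsPthPowerExponent q D := fun hP => h (by rw [if_pos hP])
    rw [if_neg hP] at h
    unfold chartTransform at h
    rw [coeff_sum] at h
    obtain ⟨d, hd, hne⟩ := Finset.exists_ne_zero_of_sum_ne_zero h
    refine ⟨d, hd, ?_⟩
    by_contra hne'
    rw [coeff_monomial, if_neg hne'] at hne
    exact hne rfl
  · rintro ⟨d, hd, rfl⟩
    have hqd : q ≤ d.degree := le_degree_of_mem_support hs W t hd
    have hP : ¬ IsPthPowerExponent q (chartExponent q (W.j t) d) := fun hP =>
      not_isPthPowerExponent_of_mem_support hs W t hd (isPthPowerExponent_of_chartExponent hqd hP)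
    rw [if_neg hP, coeff_chartTransform_chartExponent _ (fun d hd => le_degree_of_mem_support hs W t hd) hd]
    exact mem_support_iff.mp hd

/-- Coefficient transport at an untranslated move: the coefficient of the image exponent is the old coefficient.
[new] [folklore] -/
theorem coeff_succ_untranslated (hs : IsRoot q s₀) (W : ForcedWalk q s₀) (t : ℕ) (hb : W.b t = 0)
    {d : Fin 3 →₀ ℕ} (hd : d ∈ (W.st t).F.support) :
    coeff (chartExponent q (W.j t) d) (W.st (t + 1)).F = coeff d (W.st t).F := by
  classical
  have hqd : q ≤ d.degree := le_degree_of_mem_support hs W t hd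
  have hP : ¬ IsPthPowerExponent q (chartExponent q (W.j t) d) := fun hP =>
    not_isPthPowerExponent_of_mem_support hs W t hd (isPthPowerExponent_of_chartExponent hqd hP)
  rw [st_succ_F_axis W t rfl hb, coeff_deletePthPowers, if_neg hP,
    coeff_chartTransform_chartExponent _ (fun d hd => le_degree_of_mem_support hs W t hd) hd]

/-! ## §2 The residual point set of a state in a frame `(a, b ; c)` and the two chart maps `Ψ` -/

/-- The point of Hironaka's polyhedron `Δ(F/u^r ; u_a, u_b ; u_c)` carried by the exponent `D` (shade `s`, walls `r`):
`((D a − r a)/(s + r c − D c), (D b − r b)/(s + r c − D c))`.  [CJS2020 Def. 7.x/11.1: the point `A/(m − |B|)` of the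
monomial `P_{A,B} y^B u^A`, here `m = s`, `|B| = D c − r c`.] [new] -/
def resPoint (s : ℕ) (r : Fin 3 →₀ ℕ) (a b c : Fin 3) (D : Fin 3 →₀ ℕ) : ℚ × ℚ :=
  ((((D a : ℕ) : ℚ) - r a) / (((s : ℕ) : ℚ) + r c - D c), (((D b : ℕ) : ℚ) - r b) / (((s : ℕ) : ℚ) + r c - D c))

/-- The finite point set generating `Δ(F/u^r ; u_a, u_b ; u_c)`: the points of the exponents of `F` below the ceiling
`D c < s + r c`. [new] -/
def polyPts (s : ℕ) (r : Fin 3 →₀ ℕ) (a b c : Fin 3) (F : MvPolynomial (Fin 3) K) : Finset (ℚ × ℚ) :=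
  (F.support.filter fun D => D c < s + r c).image (resPoint s r a b c)

/-- CJS's `(0:1)`-move on the polygon plane (blow-up chart of the SECOND frame letter `b = u₂`):
`(x₁, x₂) ↦ (x₁, x₁ + x₂ − 1)` [CJS2020 Lemma 12.2]. [new] -/
def psi01 (x : ℚ × ℚ) : ℚ × ℚ := (x.1, x.1 + x.2 - 1)

/-- CJS's `(1:0)`-move (blow-up chart of the FIRST frame letter `a = u₁`): `(x₁, x₂) ↦ (x₁ + x₂ − 1, x₂)`
[CJS2020 Lemma 12.1]. [new] -/
def psi10 (x : ℚ × ℚ) : ℚ × ℚ := (x.1 + x.2 - 1, x.2)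

/-- `psi01_apply`: Auxiliary computation rule of the polygon calculus, VERBATIM from the lens file (docstring added by the writer for the gate's docstring lint); the statement is its type. [new; elementary] [folklore] -/
theorem psi01_apply (x : ℚ × ℚ) : psi01 x = (x.1, x.1 + x.2 - 1) := rfl
/-- `psi10_apply`: Auxiliary computation rule of the polygon calculus, VERBATIM from the lens file (docstring added by the writer for the gate's docstring lint); the statement is its type. [new; elementary] [folklore] -/
theorem psi10_apply (x : ℚ × ℚ) : psi10 x = (x.1 + x.2 - 1, x.2) := rfl

/-- `Ψ₍₁:₀₎` is `Ψ₍₀:₁₎` conjugated by the swap of the axes. [folklore] -/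
theorem psi10_eq_swap (x : ℚ × ℚ) : psi10 x = Prod.swap (psi01 (Prod.swap x)) := by
  simp only [psi10, psi01, Prod.swap]
  ring_nf

/-- Swapping the frame letters swaps the coordinates. [folklore] -/
theorem resPoint_swap (s : ℕ) (r : Fin 3 →₀ ℕ) (a b c : Fin 3) (D : Fin 3 →₀ ℕ) :
    resPoint s r b a c D = Prod.swap (resPoint s r a b c D) := rfl

/-- **Pointwise law, chart of the second letter (PROVED):** with the wall bookkeeping of an untranslated move in chart `b`
on a plateau of shade `s` (`r'_a = r_a`, `r'_b + q = s + r_a + r_b`, `r_c = r'_c = 0`) the point of the image exponent is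
`Ψ₍₀:₁₎` of the point. [CJS2020 Lemma 12.2, transcribed; new for the walk] -/
theorem resPoint_chartExponent_snd {a b c : Fin 3} (hab : a ≠ b) (hac : a ≠ c) (hbc : b ≠ c) {s : ℕ}
    {r r' : Fin 3 →₀ ℕ} (hra : r' a = r a) (hrb : r' b + q = s + r a + r b) (hrc : r c = 0) (hrc' : r' c = 0)
    {D : Fin 3 →₀ ℕ} (hqD : q ≤ D.degree) (hDc : D c < s) :
    resPoint s r' a b c (chartExponent q b D) = psi01 (resPoint s r a b c D) := by
  have hdeg : D.degree = D a + D b + D c := degree_fin3 hab hac hbc D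
  have hxa : chartExponent q b D a = D a := by rw [chartExponent_apply, if_neg hab]
  have hxc : chartExponent q b D c = D c := by rw [chartExponent_apply, if_neg hbc.symm]
  have hxb : chartExponent q b D b = D.degree - q := by rw [chartExponent_apply, if_pos rfl]
  have hden : (((s : ℕ) : ℚ) - D c) ≠ 0 := by
    have : ((D c : ℕ) : ℚ) < s := by exact_mod_cast hDc
    linarith
  have hcast1 : (((D.degree - q : ℕ) : ℕ) : ℚ) = (D a : ℚ) + D b + D c - q := by
    rw [Nat.cast_sub hqD, hdeg]; push_cast; ring
  have hcast2 : ((r' b : ℕ) : ℚ) = (s : ℚ) + r a + r b - q := by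
    have : ((r' b : ℕ) : ℚ) + q = s + r a + r b := by exact_mod_cast hrb
    linarith
  simp only [resPoint, psi01, hxa, hxc, hxb, hra, hrc, hrc', hcast1, hcast2, Nat.cast_zero, add_zero, Prod.mk.injEq]
  refine ⟨trivial, ?_⟩
  field_simp
  ring

/-- **Pointwise law, chart of the first letter (PROVED)** — the mirror image: `Ψ₍₁:₀₎`. [CJS2020 Lemma 12.1, transcribed] -/
theorem resPoint_chartExponent_fst {a b c : Fin 3} (hab : a ≠ b) (hac : a ≠ c) (hbc : b ≠ c) {s : ℕ}
    {r r' : Fin 3 →₀ ℕ} (hrb : r' b = r b) (hra : r' a + q = s + r a + r b) (hrc : r c = 0) (hrc' : r' c = 0)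
    {D : Fin 3 →₀ ℕ} (hqD : q ≤ D.degree) (hDc : D c < s) :
    resPoint s r' a b c (chartExponent q a D) = psi10 (resPoint s r a b c D) := by
  have hra' : r' a + q = s + r b + r a := by rw [hra]; ring
  rw [resPoint_swap s r' b a c, resPoint_chartExponent_snd hab.symm hbc hac hrb hra' hrc hrc' hqD hDc, psi10_eq_swap,
    ← resPoint_swap]

/-! ## §3 The walk-level transport law of the point set -/

/-- **`Ψ₍₀:₁₎`-law of the point set (PROVED).**  Untranslated move in the chart of the second frame letter `b` on a plateau of
shade `s`, with the wall bookkeeping of a run state: the new point set is exactly the `Ψ₍₀:₁₎`-image of the old one.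
[CJS2020 Lemma 12.2 for the walk; new] -/
theorem polyPts_succ_chart_snd (hs : IsRoot q s₀) (W : ForcedWalk q s₀) (t : ℕ) {a b c : Fin 3} (hab : a ≠ b)
    (hac : a ≠ c) (hbc : b ≠ c) (hj : W.j t = b) (hb : W.b t = 0) {s : ℕ}
    (hra : (W.st (t + 1)).r a = (W.st t).r a) (hrb : (W.st (t + 1)).r b + q = s + (W.st t).r a + (W.st t).r b)
    (hrc : (W.st t).r c = 0) (hrc' : (W.st (t + 1)).r c = 0) :
    polyPts s (W.st (t + 1)).r a b c (W.st (t + 1)).F = (polyPts s (W.st t).r a b c (W.st t).F).image psi01 := by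
  classical
  unfold polyPts
  rw [support_succ_untranslated hs W t hb, hj, Finset.filter_image, Finset.image_image, Finset.image_image]
  have hfilt : ((W.st t).F.support.filter fun D => chartExponent q b D c < s + (W.st (t + 1)).r c) =
      ((W.st t).F.support.filter fun D => D c < s + (W.st t).r c) := by
    refine Finset.filter_congr fun D hD => ?_
    rw [chartExponent_apply, if_neg hbc.symm, hrc, hrc']
  rw [hfilt]
  refine Finset.image_congr fun D hD => ?_
  have hD := (Finset.mem_filter.mp hD)
  show resPoint s (W.st (t + 1)).r a b c (chartExponent q b D) = psi01 (resPoint s (W.st t).r a b c D)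
  have hDc : D c < s := by have h2 := hD.2; rw [hrc, add_zero] at h2; exact h2
  exact resPoint_chartExponent_snd hab hac hbc hra hrb hrc hrc' (le_degree_of_mem_support hs W t hD.1) hDc

/-- **`Ψ₍₁:₀₎`-law of the point set (PROVED)** — untranslated move in the chart of the first frame letter `a`.
[CJS2020 Lemma 12.1 for the walk; new] -/
theorem polyPts_succ_chart_fst (hs : IsRoot q s₀) (W : ForcedWalk q s₀) (t : ℕ) {a b c : Fin 3} (hab : a ≠ b)
    (hac : a ≠ c) (hbc : b ≠ c) (hj : W.j t = a) (hb : W.b t = 0) {s : ℕ}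
    (hrb : (W.st (t + 1)).r b = (W.st t).r b) (hra : (W.st (t + 1)).r a + q = s + (W.st t).r a + (W.st t).r b)
    (hrc : (W.st t).r c = 0) (hrc' : (W.st (t + 1)).r c = 0) :
    polyPts s (W.st (t + 1)).r a b c (W.st (t + 1)).F = (polyPts s (W.st t).r a b c (W.st t).F).image psi10 := by
  classical
  unfold polyPts
  rw [support_succ_untranslated hs W t hb, hj, Finset.filter_image, Finset.image_image, Finset.image_image]
  have hfilt : ((W.st t).F.support.filter fun D => chartExponent q a D c < s + (W.st (t + 1)).r c) =
      ((W.st t).F.support.filter fun D => D c < s + (W.st t).r c) := by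
    refine Finset.filter_congr fun D hD => ?_
    rw [chartExponent_apply, if_neg hac.symm, hrc, hrc']
  rw [hfilt]
  refine Finset.image_congr fun D hD => ?_
  have hD := (Finset.mem_filter.mp hD)
  show resPoint s (W.st (t + 1)).r a b c (chartExponent q a D) = psi10 (resPoint s (W.st t).r a b c D)
  have hDc : D c < s := by have h2 := hD.2; rw [hrc, add_zero] at h2; exact h2
  exact resPoint_chartExponent_fst hab hac hbc hrb hra hrc hrc' (le_degree_of_mem_support hs W t hD.1) hDc

end Summit.ResolutionOfSingularities.ResolutionOfSingularities.Theorems.LossPolygon
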